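import Summits.ResolutionOfSingularities.ResolutionOfSingularities.Theorems.DeltaCutMirrorTransport3
import Summits.ResolutionOfSingularities.ResolutionOfSingularities.Theorems.DeltaCutRef4
import Summits.ResolutionOfSingularities.ResolutionOfSingularities.Theorems.WeightedInvariantLocalWeightedDropTrackCNCInduction
import Literature.AlgebraicGeometry.Resolution.EmbeddedResolutionExcellentSurfacesSequence
import Literature.AlgebraicGeometry.Resolution.BlowupsLocal
import HarnessLib

/-!
# SurfCut TRANSPORT (decomp-res lens 6, g30 tool for the g31 «SurfCut» frame, rows 221a/222a)

Two 0-weight frame pieces, typed once so that g31 can cite them BY NAME: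

* §W — **weak resolvability is transported along étale pull-backs and isomorphisms, and splices across an
  ARBITRARY blow-up of a weakly permissible centre** (`weakAdmissible_comap_of_etale`,
  `weakResolution_comap_of_etale`, `exists_weakResolution_comap_iff_of_isIso`, `wor_cons_of_isBlowup`): the
  column's currency `∃ t : CentreSeq Y, WeakResolution t M` is built from CHOSEN blow-ups `blowup.π C`, the
  Cossart–Jannsen–Saito towers (`IsBPermissibleSequenceB`) from arbitrary `IsBlowup τ C`; `IsBlowup.unique` +
  `comap_controlledTransform_of_flat` bridge the two.
* §R — **REALISATION OF A CJS `𝓑`-PERMISSIBLE TOWER INSIDE THE COLUMN** (`exists_stage_of_isBPermissibleSequenceB`):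
  along any `IsBPermissibleSequenceB X B σ X' B'` starting UNDER the support of a base `n`-datum `(Y, g, M)`
  (`closure X ⊆ supp M`), there is a chosen-blow-up stage `(Y₁, g₁, M₁)` (again a base `n`-datum), an
  isomorphism `e : Z' ≅ Y₁` over the base, the strict transform stays under the support
  (`closure X' ⊆ e⁻¹ supp M₁`), and weak resolutions of `M₁` splice down to weak resolutions of `M`.
  Proof: induction over the (Prop-valued, appending) tower; each CJS centre `C ⊇ 𝓘(closure X_j)` is pushed
  along the isomorphism (`isRegular_subscheme_comap_iff_of_isIso`), is weakly permissible because
  `V(C) ⊆ closure X_j ⊆ supp M_j`, the chosen blow-up is compared with `τ` by `IsBlowup.comp_iso` +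
  `IsBlowup.unique`, orders off the centre are transported (`IsBlowup.idealOrder_controlledTransform_of_not_mem`)
  and limit points are caught by the closed support upstairs (`isClosed_support_of_isBase`).

All [folklore]; no new mathematics — this is the (d1)/(d2) bookkeeping of NEXT-g31.
-/

open CategoryTheory CategoryTheory.Limits AlgebraicGeometry TopologicalSpace IsLocalRing
open Literature.AlgebraicGeometry.Resolution

namespace Summit.ResolutionOfSingularities.ResolutionOfSingularities.Theorems.DeltaCutClasses

open Summit.ResolutionOfSingularities.ResolutionOfSingularities.Theorems
open WeakOrderReduction ForcedTowerClasses
open Scheme.IdealSheafData (vanishingIdeal)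

section WTransport

variable {X U Y : Scheme.{0}}

/-- **weak admissibility is preserved along the induced sequence** of a flat, unramified, locally finite type
morphism (e.g. an open immersion, an isomorphism, an étale map): the weak (snc-free) version of
`CentreSeq.IsAdmissibleFor.comap_of_etale`. [folklore] -/
theorem weakAdmissible_comap_of_etale : ∀ {X U : Scheme.{0}} [IsLocallyNoetherian X] (s : CentreSeq X) (φ : U ⟶ X)
    [Flat φ] [FormallyUnramified φ] [LocallyOfFiniteType φ] (M : MarkedIdeal X),
    WeakAdmissible s M → WeakAdmissible (s.comap φ) (M.comap φ)
  | _, _, _, .nil _, _, _, _, _, _, _ => trivial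
  | X, U, _, .cons C rest, φ, _, _, _, M, h => by
    haveI : IsLocallyNoetherian U := LocallyOfFiniteType.isLocallyNoetherian φ
    haveI : IsLocallyNoetherian (blowup C) := (blowup.isBlowup C).isLocallyNoetherian
    haveI : IsLocallyNoetherian (blowup (C.comap φ)) := (blowup.isBlowup (C.comap φ)).isLocallyNoetherian
    haveI : Flat (blowup.comapMap C φ) := blowup.comapMap_mem @Flat C φ ‹_›
    haveI : FormallyUnramified (blowup.comapMap C φ) := blowup.comapMap_mem @FormallyUnramified C φ ‹_›
    haveI : LocallyOfFiniteType (blowup.comapMap C φ) := blowup.comapMap_mem @LocallyOfFiniteType C φ ‹_›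
    obtain ⟨hsupp, hC, hrest⟩ := h
    refine ⟨?_, Scheme.IsRegular.subscheme_comap_of_etale φ C hC, ?_⟩
    · intro u hu
      rw [Scheme.IdealSheafData.support_comap] at hu
      rw [MarkedIdeal.support_comap_of_etale']
      exact hsupp hu
    · have e := MarkedIdeal.transform_comap_of_flat' φ (s := blowup.comapMap C φ) (π := blowup.π C)
        (π' := blowup.π (C.comap φ)) (blowup.comapMap_π C φ) M C
      change WeakAdmissible (rest.comap (blowup.comapMap C φ))
        ((M.comap φ).transform (blowup.π (C.comap φ)) (C.comap φ))
      rw [e]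
      exact weakAdmissible_comap_of_etale rest (blowup.comapMap C φ) (M.transform (blowup.π C) C) hrest

/-- **a weak resolution pulls back to a weak resolution along a flat, unramified, locally finite type morphism**
(the weak version of `CentreSeq.IsResolutionOf.comap_of_etale`). [folklore] -/
theorem weakResolution_comap_of_etale [IsLocallyNoetherian X] {s : CentreSeq X} {M : MarkedIdeal X}
    (h : WeakResolution s M) (φ : U ⟶ X) [Flat φ] [FormallyUnramified φ] [LocallyOfFiniteType φ] :
    WeakResolution (s.comap φ) (M.comap φ) := by
  haveI : IsLocallyNoetherian U := LocallyOfFiniteType.isLocallyNoetherian φ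
  refine ⟨weakAdmissible_comap_of_etale s φ M h.1, ?_⟩
  haveI : Flat (s.comapι φ) := CentreSeq.flat_comapι s φ
  haveI : FormallyUnramified (s.comapι φ) :=
    CentreSeq.comapι_mem (@FormallyUnramified ⊓ @Flat) (fun _ h => h.2) s φ ⟨‹_›, ‹_›⟩ |>.1
  haveI : LocallyOfFiniteType (s.comapι φ) :=
    CentreSeq.comapι_mem (@LocallyOfFiniteType ⊓ @Flat) (fun _ h => h.2) s φ ⟨‹_›, ‹_›⟩ |>.1
  rw [CentreSeq.transformMarked_comap, MarkedIdeal.support_comap_of_etale', h.2, Set.preimage_empty]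

/-- **WEAK RESOLVABILITY IS INVARIANT UNDER ISOMORPHISMS**: `f^*M` is weakly resolvable iff `M` is. [folklore] -/
theorem exists_weakResolution_comap_iff_of_isIso (f : X ⟶ Y) [IsIso f] [IsLocallyNoetherian Y] (M : MarkedIdeal Y) :
    (∃ t : CentreSeq X, WeakResolution t (M.comap f)) ↔ ∃ t : CentreSeq Y, WeakResolution t M := by
  haveI : IsLocallyNoetherian X := LocallyOfFiniteType.isLocallyNoetherian f
  refine ⟨fun ⟨t, ht⟩ => ⟨t.comap (inv f), (weakResolution_congr _ ((M.comap f).comap (inv f)) M ?_ rfl).mp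
    (weakResolution_comap_of_etale ht (inv f))⟩, fun ⟨t, ht⟩ => ⟨t.comap f, weakResolution_comap_of_etale ht f⟩⟩
  rw [MarkedIdeal.comap_ideal, MarkedIdeal.comap_ideal, comap_comap_inv_of_isIso]

/-- **SPLICING ACROSS AN ARBITRARY BLOW-UP** of a weakly permissible centre (regular, inside the support): a weak
resolution of the transform along ANY blow-up `τ` of `Y` along `C` (not just the chosen `blowup.π C`) splices to
a weak resolution of `M` (`IsBlowup.unique`, `comap_controlledTransform_of_flat`, `wor_cons`). [folklore] -/
theorem wor_cons_of_isBlowup [IsLocallyNoetherian Y] (M : MarkedIdeal Y) (C : Y.IdealSheafData)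
    (hsub : (C.support : Set Y) ⊆ M.support) (hreg : Scheme.IsRegular C.subscheme) {Y' : Scheme.{0}} (τ : Y' ⟶ Y)
    (hτ : IsBlowup τ C) (h : ∃ t', WeakResolution t' (M.transform τ C)) : ∃ t : CentreSeq Y, WeakResolution t M := by
  obtain ⟨e, he, -⟩ := hτ.unique (blowup.isBlowup C)
  haveI : IsLocallyNoetherian (blowup C) := (blowup.isBlowup C).isLocallyNoetherian
  haveI : IsLocallyNoetherian Y' := hτ.isLocallyNoetherian
  refine wor_cons M C hsub hreg
    ((exists_weakResolution_comap_iff_of_isIso e.hom (M.transform (blowup.π C) C)).mp ?_)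
  obtain ⟨t', ht'⟩ := h
  refine ⟨t', (weakResolution_congr t' (M.transform τ C) ((M.transform (blowup.π C) C).comap e.hom) ?_ rfl).mp ht'⟩
  rw [MarkedIdeal.comap_ideal, MarkedIdeal.transform_ideal, MarkedIdeal.transform_ideal]
  rw [comap_controlledTransform_of_flat (𝟙 Y) (s := e.hom) (π := blowup.π C) (π' := τ)
    (by rw [he, Category.comp_id]) C M.ideal M.mult, Scheme.IdealSheafData.comap_id, Scheme.IdealSheafData.comap_id]

end WTransport

section Realisation

variable {k : Type} [Field k]

-- [WRITER NOTE (decomp-res writer g14): the lens's folklore lemma `support_subset_closure_of_vanishingIdeal_le`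
-- (`𝓘(closure X') ≤ C → supp C ⊆ closure X'`) stood here; it is STATEMENT-IDENTICAL to the landed
-- `TrackC.support_subset_closure_of_le` (Theorems/WeightedInvariantLocalWeightedDropTrackCNCInduction.lean; gate dedup.landed,
-- dry-run + p824490) — deleted, that module imported, its two uses below cite the landed name.]

/-- **REALISATION OF A CJS `𝓑`-PERMISSIBLE TOWER INSIDE THE COLUMN.** Along any `IsBPermissibleSequenceB X B σ X' B'`
over a base `n`-datum `(Y, g, M)` with `closure X ⊆ supp M`, there are a chosen-blow-up base `n`-datum
`(Y₁, g₁, M₁)`, an isomorphism `e : Z' ≅ Y₁` over the base (`e ≫ g₁ = σ ≫ g`), the strict transform stays under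
the support (`closure X' ⊆ e⁻¹ supp M₁`), and weak resolutions of `M₁` splice to weak resolutions of `M`; every
CJS centre is weakly permissible for the column because `V(C_j) ⊆ closure X_j ⊆ supp M_j`. [new] [folklore] -/
theorem exists_stage_of_isBPermissibleSequenceB {Y : Scheme.{0}} {g : Y ⟶ Spec (.of k)} (hB : IsBase Y g) {n : ℕ}
    {M : MarkedIdeal Y} (hM : IsDatum n M) {X B : Set Y} (hX : closure X ⊆ M.support) {Z' : Scheme.{0}}
    {σ : Z' ⟶ Y} {X' B' : Set Z'} (h : IsBPermissibleSequenceB X B σ X' B') :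
    ∃ (Y₁ : Scheme.{0}) (g₁ : Y₁ ⟶ Spec (.of k)) (M₁ : MarkedIdeal Y₁) (e : Z' ≅ Y₁),
      IsBase Y₁ g₁ ∧ IsDatum n M₁ ∧ e.hom ≫ g₁ = σ ≫ g ∧ closure X' ⊆ e.hom.base ⁻¹' M₁.support ∧
      ((∃ t₁ : CentreSeq Y₁, WeakResolution t₁ M₁) → ∃ t : CentreSeq Y, WeakResolution t M) := by
  induction h with
  | refl =>
    refine ⟨Y, g, M, Iso.refl Y, hB, hM, by simp, fun y hy => ?_, id⟩
    simpa using hX hy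
  | @blowup Z' Z'' σ X' B' h C τ hτ hreg hsub hsing hperm hnc ih =>
    obtain ⟨Y₁, g₁, M₁, e, hB₁, hM₁, hg₁, hX₁, hspl⟩ := ih
    haveI := isLocallyNoetherian_of_isBase hB₁
    haveI : IsLocallyNoetherian Z' := LocallyOfFiniteType.isLocallyNoetherian e.hom
    -- the CJS centre pushed along the isomorphism
    have hC₁reg : Scheme.IsRegular (C.comap e.inv).subscheme := (isRegular_subscheme_comap_iff_of_isIso e.inv C).mpr hreg
    have hC₁sub : ((C.comap e.inv).support : Set Y₁) ⊆ M₁.support := by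
      intro y hy
      rw [Scheme.IdealSheafData.support_comap] at hy
      have hy' : e.inv.base y ∈ closure X' :=
        Summit.ResolutionOfSingularities.ResolutionOfSingularities.Theorems.TrackC.support_subset_closure_of_le hsub hy
      have h2 : e.hom.base (e.inv.base y) ∈ M₁.support := hX₁ hy'
      rwa [Scheme.inv_hom_apply] at h2
    obtain ⟨hB₂, hM₂, -, hspl₂⟩ := blowup_facts hB₁ hM₁ (C.comap e.inv) hC₁reg hC₁sub
    -- `τ ≫ e` is a blow-up of `Y₁` along the pushed centre, hence isomorphic to the chosen one
    have hτ' : IsBlowup (τ ≫ e.hom) (C.comap e.inv) := hτ.comp_iso e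
    obtain ⟨e₂, he₂, -⟩ := hτ'.unique (blowup.isBlowup (C.comap e.inv))
    refine ⟨blowup (C.comap e.inv), blowup.π (C.comap e.inv) ≫ g₁, M₁.transform (blowup.π (C.comap e.inv)) (C.comap e.inv),
      e₂, hB₂, hM₂, ?_, ?_, fun hres => hspl (hspl₂ hres)⟩
    · rw [← Category.assoc, he₂, Category.assoc, hg₁, Category.assoc]
    · haveI := isLocallyNoetherian_of_isBase hB₂
      rw [closure_closure]
      refine closure_minimal (fun z hz => ?_) ((isClosed_support_of_isBase hB₂ _).preimage e₂.hom.continuous)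
      obtain ⟨hzX, hzC⟩ := hz
      have hπy : (blowup.π (C.comap e.inv)).base (e₂.hom.base z) = e.hom.base (τ.base z) := by
        rw [← Scheme.Hom.comp_apply, he₂, Scheme.Hom.comp_apply]
      have hnot : (blowup.π (C.comap e.inv)).base (e₂.hom.base z) ∉ ((C.comap e.inv).support : Set Y₁) := by
        rw [hπy, Scheme.IdealSheafData.support_comap]
        intro hmem
        apply hzC
        have h3 : e.inv.base (e.hom.base (τ.base z)) ∈ (C.support : Set Z') := hmem
        rwa [Scheme.hom_inv_apply] at h3
      have hin : e.hom.base (τ.base z) ∈ M₁.support := hX₁ (subset_closure hzX)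
      show ((M₁.transform _ _).mult : ℕ∞) ≤ idealOrder (M₁.transform _ _).ideal (e₂.hom.base z)
      rw [MarkedIdeal.transform_mult, MarkedIdeal.transform_ideal, hM₁.1,
        (blowup.isBlowup _).idealOrder_controlledTransform_of_not_mem M₁.ideal n hnot, hπy,
        idealOrder_eq_of_mem_support hM₁ hin]

/-- **THE F-surf INPUT STAGE, REALISED IN THE COLUMN** (CJS Thm. 1.4 in the `𝓑 = ∅` sequence form for a closed
`S ⊆ supp M` of dimension `≤ 2` over a base `n`-datum, followed by `exists_stage_of_isBPermissibleSequenceB`): the CJS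
output `(Z₁, π, X₁, B₁)` verbatim, a chosen-blow-up base `n`-datum `(Y₁, g₁, M₁)` with `e : Z₁ ≅ Y₁` over the base,
the splice, and the PERMISSIBILITY OF THE FINAL SURFACE CENTRE pushed along `e` (regular by CJS, inside `supp M₁`
because `closure X₁` is) — so that `blowup_facts hB₁ hM₁ _ ‹regular› ‹⊆ supp›` continues the column. Noetherianity
and excellence of the stage are hypotheses here (the frame discharges them once: `isNoetherian_of_isBase`,
`Scheme.IsExcellent.of_locallyOfFiniteType`). [new] [cite: CossartJannsenSaito2020, Thm. 1.4 (p. 6), Thm. 6.9 (a) (p. 83)] -/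
theorem exists_cjsStage {Y : Scheme.{0}} {g : Y ⟶ Spec (.of k)} (hB : IsBase Y g) [IsNoetherian Y]
    (hexc : Scheme.IsExcellent Y) (hCJS : CossartJannsenSaito2020EmbeddedSequenceB.{0}) {n : ℕ} {M : MarkedIdeal Y}
    (hM : IsDatum n M) (S : Set Y) (hS : IsClosed S) (hdim : topologicalKrullDim S ≤ 2) (hSsub : S ⊆ M.support) :
    ∃ (Z₁ : Scheme.{0}) (π : Z₁ ⟶ Y) (X₁ B₁ : Set Z₁) (Y₁ : Scheme.{0}) (g₁ : Y₁ ⟶ Spec (.of k)) (M₁ : MarkedIdeal Y₁)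
      (e : Z₁ ≅ Y₁),
      (IsBPermissibleSequenceB S (∅ : Set Y) π X₁ B₁ ∧ Scheme.IsRegular Z₁ ∧ IsProper π ∧ Function.Surjective π ∧
        (∃ U : Y.Opens, (U : Set Y) = Sᶜ ∧ IsIso (π ∣_ U)) ∧
        Scheme.IsRegular (vanishingIdeal ⟨closure X₁, isClosed_closure⟩).subscheme ∧ IsStrictNormalCrossingsDivisor Z₁ B₁ ∧
        π ⁻¹' S = X₁ ∪ B₁ ∧ IsTransversalWith Z₁ X₁ B₁) ∧
      IsBase Y₁ g₁ ∧ IsDatum n M₁ ∧ e.hom ≫ g₁ = π ≫ g ∧ closure X₁ ⊆ e.hom.base ⁻¹' M₁.support ∧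
      ((∃ t₁ : CentreSeq Y₁, WeakResolution t₁ M₁) → ∃ t : CentreSeq Y, WeakResolution t M) ∧
      Scheme.IsRegular ((vanishingIdeal ⟨closure X₁, isClosed_closure⟩).comap e.inv).subscheme ∧
      (((vanishingIdeal ⟨closure X₁, isClosed_closure⟩).comap e.inv).support : Set Y₁) ⊆ M₁.support := by
  obtain ⟨Z₁, π, X₁, B₁, hT, hZ₁, hπ, hsurj, hU, hX₁, hsnc, htot, htr⟩ :=
    hCJS.of_isClosed Y hB.isRegular hexc S hS hdim
  have hScl : closure S ⊆ M.support := by rw [hS.closure_eq]; exact hSsub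
  obtain ⟨Y₁, g₁, M₁, e, hB₁, hM₁, hg₁, hXsub, hspl⟩ := exists_stage_of_isBPermissibleSequenceB hB hM hScl hT
  haveI := isLocallyNoetherian_of_isBase hB₁
  haveI : IsLocallyNoetherian Z₁ := LocallyOfFiniteType.isLocallyNoetherian e.hom
  refine ⟨Z₁, π, X₁, B₁, Y₁, g₁, M₁, e, ⟨hT, hZ₁, hπ, hsurj, hU, hX₁, hsnc, htot, htr⟩, hB₁, hM₁, hg₁, hXsub, hspl,
    (isRegular_subscheme_comap_iff_of_isIso e.inv _).mpr hX₁, fun y hy => ?_⟩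
  rw [Scheme.IdealSheafData.support_comap] at hy
  have hy' : e.inv.base y ∈ closure X₁ :=
    Summit.ResolutionOfSingularities.ResolutionOfSingularities.Theorems.TrackC.support_subset_closure_of_le le_rfl hy
  have h2 : e.hom.base (e.inv.base y) ∈ M₁.support := hXsub hy'
  rwa [Scheme.inv_hom_apply] at h2

end Realisation

end Summit.ResolutionOfSingularities.ResolutionOfSingularities.Theorems.DeltaCutClasses
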